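import Summits.SmoothPoincare4.SmoothPoincare4.Theorems.CylinderEntropyCylinderRungTwoAllardDensityStaticSlice
import Literature.MeasureTheory.Hausdorff.SphereCapAsymptotics
import Literature.Geometry.GeometricMeasureTheory.AllardIntegralDensityOfLimits
import HarnessLib

/-!
# Uniform lower `4`-density bound for the static slices `S⁴ × {h}` of `N = S⁴ × ℝ ⊂ ℝ⁶`

Model case (satisfiability / shape check) of conclusion (b') of the named fact
`Literature.Geometry.Riemannian.White2005_localRegularity_cylinderFlowSheet`
(line `killing-flux`, crux `CylinderRungTwo`, stmt-SmoothPoincare4-7631): there are UNIVERSAL constants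
`c > 0` and `r₀ > 0` such that for every height `h`, every point `x` of the slice
`S⁴ × {h} = {z | ∑_{i<5} zᵢ² = 1 ∧ z₅ = h}` and every radius `0 < r ≤ r₀`,
`c · r⁴ ≤ μH[4] (slice ∩ B(x, r))` (Mathlib's un-normalised `μH[4]` in `ℝ⁶`).

Proof: write `x = sliceMap h q` with `q ∈ S⁴` (`range_sliceMap`); the slice cap in `B(x, r)` has the
`μH[4]`-measure of the cap `S⁴ ∩ B(q, r)` of the unit sphere of `ℝ⁵`
(`hausdorffMeasure_ball_sliceMap_inter_range`); the lower chordal-cap comparison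
`Literature.MeasureTheory.Hausdorff.mul_hausdorffMeasure_ball_le_unitSphere_inter_ball` bounds the
latter below by `(1 - r²/4)² · μH[4](B⁴(0, r)) = (1 - r²/4)² · r⁴ · μH[4](B⁴(0, 1))`
(`Allard1972.hausdorffMeasure_ball_fin_four`), and `(1 - r²/4)² ≥ 9/16` for `r ≤ 1`. We take
`r₀ = 1` and `c = (9/16) · μH[4](B⁴(0, 1))` (a positive real since `0 < μH[4](B⁴(0,1)) < ⊤`).
-/

noncomputable section

open MeasureTheory Set Filter
open scoped ENNReal NNReal Topology BigOperators

set_option linter.dupNamespace false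

namespace Summit.SmoothPoincare4.SmoothPoincare4.Cruxes.CylinderRungTwo.KillingFlux

open Literature.Geometry.Manifold.CylinderSlice
open Literature.MeasureTheory.Hausdorff
open Literature.Geometry.GeometricMeasureTheory.Allard1972

/-- For `0 < r ≤ 1`, `√(1 - r²/4)⁴ = (1 - r²/4)² ≥ (3/4)² = 9/16`. [folklore] -/
theorem le_sqrt_one_sub_sq_div_four_pow_four {r : ℝ} (hr : 0 < r) (hr1 : r ≤ 1) :
    (9 / 16 : ℝ) ≤ Real.sqrt (1 - r ^ 2 / 4) ^ 4 := by
  have h0 : 0 ≤ 1 - r ^ 2 / 4 := by nlinarith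
  have h34 : 3 / 4 ≤ 1 - r ^ 2 / 4 := by nlinarith
  calc (9 / 16 : ℝ) ≤ (1 - r ^ 2 / 4) ^ 2 := by nlinarith
    _ = (Real.sqrt (1 - r ^ 2 / 4) ^ 2) ^ 2 := by rw [Real.sq_sqrt h0]
    _ = Real.sqrt (1 - r ^ 2 / 4) ^ 4 := by ring

/-- **Uniform lower bound for the caps of the unit `S⁴ ⊂ ℝ⁵`, for Mathlib's `μH[4]`**:
for `q ∈ S⁴` and `0 < r ≤ 1`, `(9/16) · μH[4](B⁴(0,1)) · r⁴ ≤ μH[4] (S⁴ ∩ B(q, r))`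
(lower chordal-cap comparison with the flat `4`-disc and Haar scaling of the disc). [folklore] -/
theorem ofReal_mul_pow_four_le_hausdorffMeasure_sphere_inter_ball
    (q : Metric.sphere (0 : EuclideanSpace ℝ (Fin 5)) 1) {r : ℝ} (hr : 0 < r) (hr1 : r ≤ 1) :
    ENNReal.ofReal
        (9 / 16 * (μH[4] (Metric.ball (0 : EuclideanSpace ℝ (Fin 4)) 1)).toReal * r ^ 4) ≤
      μH[4] (Metric.sphere (0 : EuclideanSpace ℝ (Fin 5)) 1 ∩
        Metric.ball (q : EuclideanSpace ℝ (Fin 5)) r) := by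
  have hq : ‖(q : EuclideanSpace ℝ (Fin 5))‖ = 1 := mem_sphere_zero_iff_norm.mp q.2
  have hr2 : r ^ 2 < 2 := by nlinarith
  -- the cap comparison is stated for `μH[((4 : ℕ) : ℝ)]`; restated for `μH[(4 : ℝ)]` (defeq)
  have hcap : ENNReal.ofReal (Real.sqrt (1 - r ^ 2 / 4) ^ 4) *
        μH[4] (Metric.ball (0 : EuclideanSpace ℝ (Fin 4)) r) ≤
      μH[4] (Metric.sphere (0 : EuclideanSpace ℝ (Fin 5)) 1 ∩
        Metric.ball (q : EuclideanSpace ℝ (Fin 5)) r) :=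
    mul_hausdorffMeasure_ball_le_unitSphere_inter_ball (E := EuclideanSpace ℝ (Fin 5)) (d := 4)
      finrank_euclideanSpace_fin (by norm_num) hq hr hr2
  refine le_trans ?_ hcap
  rw [hausdorffMeasure_ball_fin_four hr]
  have hBt : μH[4] (Metric.ball (0 : EuclideanSpace ℝ (Fin 4)) 1) ≠ ⊤ :=
    hausdorffMeasure_unitBall_fin_four_lt_top.ne
  have h916 : (0 : ℝ) ≤ 9 / 16 := by norm_num
  have h916B :
      (0 : ℝ) ≤ 9 / 16 * (μH[4] (Metric.ball (0 : EuclideanSpace ℝ (Fin 4)) 1)).toReal :=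
    mul_nonneg h916 ENNReal.toReal_nonneg
  calc ENNReal.ofReal
        (9 / 16 * (μH[4] (Metric.ball (0 : EuclideanSpace ℝ (Fin 4)) 1)).toReal * r ^ 4)
      = ENNReal.ofReal (9 / 16) *
          (ENNReal.ofReal (r ^ 4) * μH[4] (Metric.ball (0 : EuclideanSpace ℝ (Fin 4)) 1)) := by
        rw [ENNReal.ofReal_mul h916B, ENNReal.ofReal_mul h916, ENNReal.ofReal_toReal hBt]
        ring
    _ ≤ ENNReal.ofReal (Real.sqrt (1 - r ^ 2 / 4) ^ 4) *
          (ENNReal.ofReal (r ^ 4) * μH[4] (Metric.ball (0 : EuclideanSpace ℝ (Fin 4)) 1)) := by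
        exact mul_le_mul_left
          (ENNReal.ofReal_le_ofReal (le_sqrt_one_sub_sq_div_four_pow_four hr hr1)) _

/-- **Uniform lower `4`-density bound for the slices `S⁴ × {h}`** (model case of conclusion (b') of
the White local-regularity named fact on the static slice flow): with `c = (9/16) · μH[4](B⁴(0,1)) > 0`
and `r₀ = 1`, for every height `h`, every `x` in the slice `{z | ∑_{i<5} zᵢ² = 1 ∧ z₅ = h}` and every
`0 < r ≤ r₀`, `ENNReal.ofReal (c * r ^ 4) ≤ μH[4] (slice ∩ B(x, r))`. [folklore] -/
theorem helper_sliceLowerAreaBound : ∃ c : ℝ, 0 < c ∧ ∃ r₀ : ℝ, 0 < r₀ ∧ ∀ (h : ℝ) (x : EuclideanSpace ℝ (Fin 6)), x ∈ {z : EuclideanSpace ℝ (Fin 6) | ∑ i : Fin 5, z (Fin.castSucc i) ^ 2 = 1 ∧ z 5 = h} → ∀ r : ℝ, 0 < r → r ≤ r₀ → ENNReal.ofReal (c * r ^ 4) ≤ μH[4] ({z : EuclideanSpace ℝ (Fin 6) | ∑ i : Fin 5, z (Fin.castSucc i) ^ 2 = 1 ∧ z 5 = h} ∩ Metric.ball x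 r) := by
  refine ⟨9 / 16 * (μH[4] (Metric.ball (0 : EuclideanSpace ℝ (Fin 4)) 1)).toReal, ?_, 1, one_pos,
    ?_⟩
  · have hB : 0 < (μH[4] (Metric.ball (0 : EuclideanSpace ℝ (Fin 4)) 1)).toReal :=
      ENNReal.toReal_pos hausdorffMeasure_unitBall_fin_four_pos.ne'
        hausdorffMeasure_unitBall_fin_four_lt_top.ne
    positivity
  · intro h x hx r hr hr1
    rw [← range_sliceMap h] at hx ⊢
    obtain ⟨q, rfl⟩ := hx
    rw [Set.inter_comm, hausdorffMeasure_ball_sliceMap_inter_range]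
    exact ofReal_mul_pow_four_le_hausdorffMeasure_sphere_inter_ball q hr hr1

end Summit.SmoothPoincare4.SmoothPoincare4.Cruxes.CylinderRungTwo.KillingFlux

end
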